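import Literature.AlgebraicGeometry.HodgeTheory.SmoothHypersurfaceAtlas
import Literature.AlgebraicTopology.SingularHomology.TransverseDiscFunctional
import Literature.AlgebraicTopology.SingularHomology.FundamentalClassExistence
import Literature.AlgebraicTopology.SingularHomology.UniversalCoefficientsProofs
import Literature.AlgebraicTopology.SingularHomology.LocalHomologyUniverse
import Mathlib.Analysis.Calculus.Deriv.Polynomial
import Literature.AlgebraicGeometry.HodgeTheory.HypersurfaceComplementMorse
import Literature.AlgebraicGeometry.HodgeTheory.HypersurfaceJacobian
import Literature.AlgebraicGeometry.HodgeTheory.VanishingCohomologyNontrivialProofs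
import Literature.AlgebraicGeometry.Motives.ComplexPointsOrientation
import Literature.AlgebraicTopology.SingularHomology.IntegralClassRingChange
import Literature.Topology.FourManifolds.ComplexProjectiveSpaceCohomology
import HarnessLib

/-!
# Lefschetz for smooth hypersurfaces in the upper range, the degree of a smooth hypersurface,
# and the discharge of `Voisin2003_smoothHypersurface_algebraicClasses_eq_top`

Family `hodge`, layer `Literature/AlgebraicGeometry/HodgeTheory`. This file proves the named fact
`Voisin2003_smoothHypersurface_algebraicClasses_eq_top` (file `HypersurfaceLefschetz`): for a smooth
hypersurface `Y ⊂ ℙ^{n+1}_ℂ` of dimension `n` and `0 < p < n`, `2p ≠ n`, every class of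
`H²ᵖ(Y(ℂ); ℂ)` is algebraic. By `algebraicClasses_eq_top_of_surjective_map`
(`HypersurfaceLefschetzProofs`) it suffices that `ι^* : H²ᵖ(ℙ^{n+1}(ℂ); ℂ) → H²ᵖ(Y(ℂ); ℂ)` be onto.

* `2p < n` (Voisin II Thm. 1.23 / Cor. 1.24): Lefschetz's theorem on hyperplane sections, PROVED in
  the tree through duality and the Andreotti–Frankel vanishing
  (`surjective_map_of_isZero_singularHomology_compl_range`,
  `isZero_singularHomology_compl_range_smoothHypersurface`).
* `n < 2p < 2n` (Voisin II Cor. 1.25, "by Poincaré duality … `H²ᵏ(X, ℤ) = ℤα`, `⟨α, h^{n−k}⟩ = 1`",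
  with `hᵏ = d·α ≠ 0` since `⟨hᵏ, h^{n−k}⟩ = deg Y = d`): here WITHOUT hard Lefschetz —
  (i) `dim H²ᵖ(Y(ℂ)) = dim H^{2n−2p}(Y(ℂ)) ≤ dim H^{2n−2p}(ℙ^{n+1}(ℂ)) = 1` (Poincaré duality on the
  complex manifold `Y(ℂ)`, `ComplexPoints.finrank_singularCohomology_eq_of_add_eq`; the lower range;
  `b₂ₖ(ℂℙᴺ) = 1`, `ComplexProjectiveSpaceCohomology`);
  (ii) `ι^* ≠ 0` on `H²ᵖ(ℙ^{n+1}(ℂ))`: by the cup product structure of `H*(ℂℙᴺ; ℂ)`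
  (`cupProduct_ne_zero_of_add_le`) it suffices that `ι^* ≠ 0` on `H²ⁿ`, and this is the degree:
  in transversal normal form (`HypersurfaceTransversalLine`, an invertible linear change of
  coordinates, transported along the induced homeomorphisms) the integral fundamental class of the
  complex manifold `Y(ℂ) ≅ Z_G` pairs non-trivially with `ι^*α` for some integral `α`
  (`SmoothHypersurfaceDegree`, Milnor's sum over the `d` transversal crossings of a line, each
  `+1`), which survives to complex coefficients (`IntegralClassRingChange`).

Main results: `surjective_map_of_upper` (the upper range), and the DISCHARGE
**`Voisin2003_smoothHypersurface_algebraicClasses_eq_top_holds`**. Everything is proved; no named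
facts, no hypotheses beyond those of the fact.

## Part I — the degree of a smooth hypersurface is non-zero: `ι_*[Z_F] ≠ 0` in `H₂ₙ(ℂℙⁿ⁺¹; ℤ)`

Family `hodge`, layer `Literature/AlgebraicGeometry/HodgeTheory`. The topological content of
"a smooth hypersurface `Y ⊂ ℙⁿ⁺¹` of degree `d` has `⟨hⁿ, [Y]⟩ = d ≠ 0`" (Voisin, *Hodge Theory
and Complex Algebraic Geometry II* (2003), §1.2.3 proof of Cor. 1.24–1.25 / Rem. 1.26: "a curve
`C = X ∩ ℙ²` is of degree `d` and is thus of class `dα`"; Griffiths–Harris Ch. 1 §3: the degree is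
the number of points of intersection with a generic line, each counted `+1` since "complex
submanifolds intersect positively"; Milnor, *Lectures on the h-cobordism theorem* (1965), Lemma 6.3:
the intersection number is the sum of the local intersection numbers at the transversal
crossings), in the form needed by the Lefschetz argument for the upper range of degrees:

* **`exists_kroneckerPairing_map_fundamentalClass_ne_zero`** — for the smooth hypersurface
  `Z_G ⊂ ℂℙⁿ⁺¹` of a non-singular form `G` in TRANSVERSAL NORMAL FORM (`G(e₀) ≠ 0` and
  `g(t) = G(t, 1, 0, …, 0)` with only simple roots, at least one: `HypersurfaceTransversalLine`),
  there is an integral class `α ∈ H²ⁿ(ℂℙⁿ⁺¹; ℤ)` with `⟨ι^* α, [Z_G]⟩ ≠ 0`, `[Z_G]` the fundamental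
  class of the complex orientation of `SmoothHypersurfaceAtlas`.

Proof (Milnor's Lemma 6.3 in the tree's homological form
`TransverseDiscDatum.functional_ofAbsolute_map_eq_sum`, `…TransverseDiscFunctional`): in the
punctured space `X' = ℂℙⁿ⁺¹ ∖ {[e₀]}` (which contains `Z_G` since `G(e₀) ≠ 0`) the affine line
`P = {[s : t : 0 : ⋯ : 0]} ∖ {[e₀]}` is a closed stratum with the global normal coordinate
`K = (z₂/z₁, …, z_{n+1}/z₁)` on the affine chart `N = {z₁ ≠ 0}`; `Z_G` meets `P` exactly at the
points `[t : 1 : 0 : ⋯ : 0]`, `g(t) = 0`, and at each of them the graph chart of slot `w₀` over the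
coordinates `(w₁, …, wₙ) = K` (valid since `∂₀` of the dehomogenised form is `g'(t) ≠ 0`) is a
Euclidean model in which `K ∘ ι` is the identity: local degree `+1`, and the local orientation class
is the model class by construction of the orientation (`orientation_localClass_symm_restrOpen`).
Hence the transverse-disc functional takes the value `(#roots) · w₀ ≠ 0` on `ι_*[Z_G]`, which is
therefore non-zero in `H₂ₙ(X'; ℤ) ≅ H₂ₙ(ℂℙⁿ⁺¹; ℤ)` (the puncture has local homology only in degree
`2n + 2`), and pairs non-trivially with some integral cohomology class (universal coefficients,
`kroneckerPairing_surjective`). Everything is proved; no named facts.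

## Part II — the upper range and the discharge

See the summary above: `surjective_map_of_upper` and
`Voisin2003_smoothHypersurface_algebraicClasses_eq_top_holds` (namespace
`Literature.AlgebraicGeometry.HodgeTheory`, after the `HypersurfaceDegree` part).

## References

* [VoisinHodgeII2003] C. Voisin, Hodge Theory and Complex Algebraic Geometry II, CUP 2003, §1.2.3
  Cor. 1.24–1.25, Rem. 1.26.
* [GriffithsHarrisPrinciples1978] P. Griffiths, J. Harris, Principles of Algebraic Geometry,
  Wiley 1978, Ch. 0 §4 (intersection of cycles, positivity for complex submanifolds), Ch. 1 §3.
* [MilnorHCobordism1965] J. Milnor, Lectures on the h-cobordism theorem, Princeton 1965, Lemma 6.3.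
* [HatcherAT2002] A. Hatcher, Algebraic Topology, CUP 2002, §3.1 Thm. 3.2, §3.3 p. 231.
-/

noncomputable section

open CategoryTheory Set Function Topology Filter Metric
open scoped ContDiff

namespace Literature.AlgebraicGeometry.HodgeTheory

open Literature.Topology.FourManifolds Literature.Topology.FourManifolds.ComplexProjectiveSpace
  Literature.AlgebraicTopology.SingularHomology

namespace HypersurfaceDegree

variable {n : ℕ}

/-! ### The point `[e₀]`, the punctured space, the line and the normal coordinate -/

/-- The non-zero vector `e₀`. [folklore] -/
def e₀ : {v : Fin (n + 2) → ℂ // v ≠ 0} := ⟨Pi.single 0 1, by simp⟩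

/-- The point `[e₀] = [1 : 0 : ⋯ : 0]`. [folklore] -/
def pInf : ComplexProjectiveSpace (n + 1) := mk e₀

/-- The punctured projective space `X' = ℂℙⁿ⁺¹ ∖ {[e₀]}`. [folklore] -/
abbrev Xp (n : ℕ) : Type := ↥({pInf}ᶜ : Set (ComplexProjectiveSpace (n + 1)))

/-- **The line `{[s : t : 0 : ⋯ : 0]}`**: all homogeneous coordinates of index `≥ 2` vanish.
[folklore] -/
def line : Set (ComplexProjectiveSpace (n + 1)) := {x | ∀ j : Fin (n + 2), 2 ≤ (j : ℕ) → ¬ CoordNeZero j x}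

/-- `[v] ∈ line ⟺ v_j = 0` for `j ≥ 2`. [folklore] -/
theorem mk_mem_line_iff (v : {v : Fin (n + 2) → ℂ // v ≠ 0}) :
    mk v ∈ (line : Set (ComplexProjectiveSpace (n + 1))) ↔
      ∀ j : Fin (n + 2), 2 ≤ (j : ℕ) → (v : Fin (n + 2) → ℂ) j = 0 := by
  simp [line]

/-- The line is closed. [folklore] -/
theorem isClosed_line : IsClosed (line : Set (ComplexProjectiveSpace (n + 1))) := by
  have : (line : Set (ComplexProjectiveSpace (n + 1))) =
      ⋂ j : Fin (n + 2), ⋂ (_ : 2 ≤ (j : ℕ)), {x | CoordNeZero j x}ᶜ := by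
    ext x; simp [line]
  rw [this]
  exact isClosed_iInter fun j => isClosed_iInter fun _ => (isOpen_setOf_coordNeZero j).isClosed_compl

/-- A point of the line other than `[e₀]` has `z₁ ≠ 0`. [folklore] -/
theorem coordNeZero_one_of_mem_line {x : ComplexProjectiveSpace (n + 1)} (hx : x ∈ line) (hne : x ≠ pInf) :
    CoordNeZero 1 x := by
  induction x using ind with
  | h v =>
    rw [mk_mem_line_iff] at hx
    intro h1
    apply hne
    change mk v = mk e₀
    have hv1 : (v : Fin (n + 2) → ℂ) 1 = 0 := h1
    have hvj : ∀ j : Fin (n + 2), j ≠ 0 → (v : Fin (n + 2) → ℂ) j = 0 := by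
      intro j hj0
      by_cases hj1 : j = 1
      · rw [hj1]; exact hv1
      · apply hx j
        have h0 : (j : ℕ) ≠ 0 := fun h => hj0 (Fin.ext h)
        have h1' : (j : ℕ) ≠ 1 := fun h => hj1 (Fin.ext h)
        omega
    have hv0 : (v : Fin (n + 2) → ℂ) 0 ≠ 0 := by
      intro h0
      apply v.2
      funext j
      by_cases hj : j = 0
      · rw [hj]; exact h0
      · exact hvj j hj
    refine (mk_eq_mk_iff _ _).2 ⟨Units.mk0 _ hv0, ?_⟩
    funext j
    change ((v : Fin (n + 2) → ℂ) 0 • (Pi.single (0 : Fin (n + 2)) (1 : ℂ) : Fin (n + 2) → ℂ)) j =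
      (v : Fin (n + 2) → ℂ) j
    by_cases hj : j = 0
    · rw [hj]; simp
    · rw [hvj j hj, Pi.smul_apply, Pi.single_eq_of_ne hj, smul_zero]

/-- **The normal coordinates** `(z₂/z₁, …, z_{n+1}/z₁) ∈ ℂⁿ` on the chart `{z₁ ≠ 0}`: the affine
coordinates of chart `1` with slot `0` (`= z₀/z₁`) removed. [folklore] -/
def tailCoord (x : ComplexProjectiveSpace (n + 1)) : Fin n → ℂ :=
  Fin.removeNth 0 (affineCoordComplex 1 x)

/-- On `{z₁ ≠ 0}` the normal coordinates vanish exactly on the line. [folklore] -/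
theorem tailCoord_eq_zero_iff {x : ComplexProjectiveSpace (n + 1)} (h1 : CoordNeZero 1 x) :
    tailCoord x = 0 ↔ x ∈ line := by
  induction x using ind with
  | h v =>
    have hv1 : (v : Fin (n + 2) → ℂ) 1 ≠ 0 := h1
    rw [mk_mem_line_iff]
    constructor
    · intro h j hj
      obtain ⟨j', rfl⟩ : ∃ j' : Fin n, j = (1 : Fin (n + 2)).succAbove (Fin.succ j') := by
        rcases Fin.eq_self_or_eq_succAbove 1 j with rfl | ⟨l, rfl⟩
        · simp at hj
        rcases Fin.eq_zero_or_eq_succ l with rfl | ⟨j', rfl⟩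
        · simp at hj
        · exact ⟨j', rfl⟩
      have := congr_fun h j'
      simp only [tailCoord, affineCoordComplex_mk, Fin.removeNth, Pi.zero_apply, div_eq_zero_iff] at this
      exact this.resolve_right hv1
    · intro h
      funext j'
      simp only [tailCoord, affineCoordComplex_mk, Fin.removeNth, Pi.zero_apply, div_eq_zero_iff]
      left
      apply h
      simp [Fin.succAbove, Fin.lt_def]

/-- The normal coordinates are continuous on `{z₁ ≠ 0}`. [folklore] -/
theorem continuousOn_tailCoord :
    ContinuousOn (tailCoord : ComplexProjectiveSpace (n + 1) → Fin n → ℂ) {x | CoordNeZero 1 x} :=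
  (continuous_pi fun _ => continuous_apply _ : Continuous fun w : Fin (n + 1) → ℂ => Fin.removeNth 0 w)
    |>.comp_continuousOn (continuousOn_affineCoordComplex 1)

/-- Radial clamping to the closed unit ball. [folklore] -/
def clamp (u : EuclideanSpace ℝ (Fin (2 * n))) : EuclideanSpace ℝ (Fin (2 * n)) := (max 1 ‖u‖)⁻¹ • u

/-- The clamp is continuous. [folklore] -/
theorem continuous_clamp : Continuous (clamp : EuclideanSpace ℝ (Fin (2 * n)) → _) := by
  refine Continuous.smul (Continuous.inv₀ (continuous_const.max continuous_norm) fun u => ?_) continuous_id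
  exact (lt_of_lt_of_le one_pos (le_max_left _ _)).ne'

/-- The clamp lands in the closed unit ball. [folklore] -/
theorem norm_clamp_le (u : EuclideanSpace ℝ (Fin (2 * n))) : ‖clamp u‖ ≤ 1 := by
  have hm : 0 < max 1 ‖u‖ := lt_of_lt_of_le one_pos (le_max_left _ _)
  rw [clamp, norm_smul, norm_inv, Real.norm_eq_abs, abs_of_pos hm, inv_mul_le_iff₀ hm, mul_one]
  exact le_max_right _ _

/-- The clamp vanishes only at `0`. [folklore] -/
theorem clamp_eq_zero_iff (u : EuclideanSpace ℝ (Fin (2 * n))) : clamp u = 0 ↔ u = 0 := by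
  have hm : 0 < max 1 ‖u‖ := lt_of_lt_of_le one_pos (le_max_left _ _)
  rw [clamp, smul_eq_zero, inv_eq_zero]
  exact ⟨fun h => h.resolve_left hm.ne', Or.inr⟩

/-- The clamp is the identity on the closed unit ball. [folklore] -/
theorem clamp_of_norm_le {u : EuclideanSpace ℝ (Fin (2 * n))} (hu : ‖u‖ ≤ 1) : clamp u = u := by
  rw [clamp, max_eq_left hu, inv_one, one_smul]

/-! ### The transverse disc datum -/

/-- The transverse disc `u ↦ [0 : 1 : R⁻¹ u]`. [folklore] -/
def discMap (u : EuclideanSpace ℝ (Fin (2 * n))) : ComplexProjectiveSpace (n + 1) :=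
  mk (homogenize 1 (Fin.insertNth 0 0 ((realCoordinates n).symm u)))

/-- The transverse disc avoids `[e₀]`. [folklore] -/
theorem discMap_ne_pInf (u : EuclideanSpace ℝ (Fin (2 * n))) : discMap u ≠ pInf := by
  intro h
  have h1 : CoordNeZero 1 (discMap (n := n) u) := by
    change (Fin.insertNth 1 (1 : ℂ) (Fin.insertNth 0 0 ((realCoordinates n).symm u)) : Fin (n + 2) → ℂ) 1 ≠ 0
    rw [Fin.insertNth_apply_same]; exact one_ne_zero
  rw [h] at h1
  apply h1
  change (Pi.single (0 : Fin (n + 2)) (1 : ℂ) : Fin (n + 2) → ℂ) 1 = 0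
  rw [← Fin.succ_zero_eq_one]
  exact Pi.single_eq_of_ne (Fin.succ_ne_zero 0) _

/-- The transverse disc is injective. [folklore] -/
theorem discMap_injective : Injective (discMap : EuclideanSpace ℝ (Fin (2 * n)) → _) := by
  intro u u' h
  have := congrArg (affineCoordComplex 1) h
  rw [discMap, discMap, affineCoordComplex_mk_homogenize, affineCoordComplex_mk_homogenize] at this
  have h2 := congrArg (Fin.removeNth 0) this
  rw [Fin.removeNth_insertNth, Fin.removeNth_insertNth] at h2
  exact (realCoordinates n).symm.injective h2

/-- **The transverse disc datum of the line in the punctured projective space**: stratum the affine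
line `P = line ∖ [e₀]`, neighbourhood `N = {z₁ ≠ 0}`, normal coordinate the clamped realified
`(z₂/z₁, …, z_{n+1}/z₁)`, disc `u ↦ [0 : 1 : u]` (Milnor 1965, proof of Lemma 6.3).
[cite: MilnorHCobordism1965, Lemma 6.3] -/
def datum (n : ℕ) : TransverseDiscDatum (Xp n) (2 * n) where
  P := {x | x.1 ∈ line}
  N := {x | CoordNeZero 1 x.1}
  isClosed_P := isClosed_line.preimage continuous_subtype_val
  isOpen_N := (isOpen_setOf_coordNeZero 1).preimage continuous_subtype_val
  subset x hx := coordNeZero_one_of_mem_line hx x.2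
  m u := ⟨discMap u, discMap_ne_pInf u⟩
  r := 1
  r_pos := one_pos
  continuousOn_m := by
    refine Continuous.continuousOn ?_
    refine Continuous.subtype_mk ?_ _
    exact continuous_mk.comp ((continuous_homogenize 1).comp
      ((by fun_prop : Continuous fun w : Fin n → ℂ => (Fin.insertNth 0 (0 : ℂ) w : Fin (n + 1) → ℂ)).comp
        (realCoordinates n).symm.continuous))
  injOn_m u _ u' _ h := discMap_injective (congrArg Subtype.val h)
  K := ⟨fun x => clamp (realCoordinates n (tailCoord x.1.1)),
    continuous_clamp.comp ((realCoordinates n).continuous.comp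
      (continuousOn_tailCoord.comp_continuous (continuous_subtype_val.comp continuous_subtype_val)
        fun x => x.2))⟩
  norm_le x := norm_clamp_le _
  eq_zero_iff x := by
    change clamp (realCoordinates n (tailCoord x.1.1)) = 0 ↔ x.1.1 ∈ line
    rw [clamp_eq_zero_iff, map_eq_zero_iff _ (realCoordinates n).injective, tailCoord_eq_zero_iff x.2]

/-! ### The hypersurface in transversal normal form -/

/-- **A smooth hypersurface in transversal normal form**: a homogeneous non-singular form `G` with
`G(e₀) ≠ 0`, together with the non-zero polynomial `g(t) = G(t, 1, 0, …, 0)` of its restriction to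
the coordinate line, all of whose roots are simple (the output of
`TransversalLine.exists_linSubst_transversal_line`). [cite: GriffithsHarrisPrinciples1978, Ch. 1 §3] -/
structure Setup (n : ℕ) where
  /-- the form -/
  G : MvPolynomial (Fin (n + 2)) ℂ
  /-- its degree -/
  d : ℕ
  hG : G.IsHomogeneous d
  hNS : IsNonsingular G
  hG₀ : MvPolynomial.eval (Pi.single 0 1) G ≠ 0
  /-- the restriction to the line `{[t : 1 : 0 : ⋯ : 0]}` -/
  g : Polynomial ℂ
  hg0 : g ≠ 0
  hg : ∀ t : ℂ, g.eval t = MvPolynomial.eval (Fin.cons t (Pi.single 0 1)) G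
  hsimple : ∀ t : ℂ, g.eval t = 0 → (Polynomial.derivative g).eval t ≠ 0

namespace Setup

variable (S : Setup n)

/-- The hypersurface `Z_G`. [folklore] -/
abbrev Z : Type := Model S.G S.hG S.hNS

/-- `Z_G` avoids `[e₀]` since `G(e₀) ≠ 0`. [folklore] -/
theorem ne_pInf_of_mem_zeroSet {q : ComplexProjectiveSpace (n + 1)} (hq : q ∈ zeroSet S.G S.hG) : q ≠ pInf := by
  rintro rfl
  rw [pInf, e₀, mk_mem_zeroSet_iff] at hq
  exact S.hG₀ hq

/-- The inclusion `Z_G → X' = ℂℙⁿ⁺¹ ∖ {[e₀]}`. [folklore] -/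
def inclXp : C(S.Z, Xp n) :=
  ⟨fun q => ⟨q.1, S.ne_pInf_of_mem_zeroSet q.2⟩, (continuous_subtype_val).subtype_mk _⟩

/-- The inclusion `Z_G → ℂℙⁿ⁺¹`. [folklore] -/
def inclC : C(S.Z, ComplexProjectiveSpace (n + 1)) := ⟨Subtype.val, continuous_subtype_val⟩

/-- A point of `Z_G` on the line has `z₁ ≠ 0`. [folklore] -/
theorem coordNeZero_one_of_mem_line' {q : ComplexProjectiveSpace (n + 1)}
    (hq : q ∈ zeroSet S.G S.hG) (hl : q ∈ line) : CoordNeZero 1 q :=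
  coordNeZero_one_of_mem_line hl (S.ne_pInf_of_mem_zeroSet hq)

end Setup

/-! ### The crossings `[t : 1 : 0 : ⋯ : 0]`, `g(t) = 0` -/

/-- The vector `(t, 1, 0, …, 0)`. [folklore] -/
def lineVec (t : ℂ) : {v : Fin (n + 2) → ℂ // v ≠ 0} :=
  ⟨Fin.cons t (Pi.single 0 1), fun h => by
    have := congr_fun h 1
    rw [← Fin.succ_zero_eq_one, Fin.cons_succ, Pi.single_eq_same] at this
    exact one_ne_zero this⟩

/-- Coordinate `1` of `(t, 1, 0, …, 0)` is `1`. [folklore] -/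
theorem lineVec_one (t : ℂ) : ((lineVec (n := n) t : Fin (n + 2) → ℂ)) 1 = 1 := by
  change (Fin.cons t (Pi.single (0 : Fin (n + 1)) (1 : ℂ)) : Fin (n + 2) → ℂ) 1 = 1
  rw [← Fin.succ_zero_eq_one, Fin.cons_succ, Pi.single_eq_same]

/-- Coordinate `0` of `(t, 1, 0, …, 0)` is `t`. [folklore] -/
theorem lineVec_zero (t : ℂ) : ((lineVec (n := n) t : Fin (n + 2) → ℂ)) 0 = t := rfl

/-- The coordinates `≥ 2` of `(t, 1, 0, …, 0)` vanish. [folklore] -/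
theorem lineVec_succ_succ (t : ℂ) (j : Fin n) :
    ((lineVec (n := n) t : Fin (n + 2) → ℂ)) (Fin.succ (Fin.succ j)) = 0 := by
  change (Fin.cons t (Pi.single (0 : Fin (n + 1)) (1 : ℂ)) : Fin (n + 2) → ℂ) (Fin.succ (Fin.succ j)) = 0
  rw [Fin.cons_succ, Pi.single_eq_of_ne (Fin.succ_ne_zero j)]

/-- `(1 : Fin (n+2)).succAbove` on `succ j'` is `succ (succ j')`. [folklore] -/
theorem one_succAbove_succ (j' : Fin n) :
    (1 : Fin (n + 2)).succAbove (Fin.succ j') = Fin.succ (Fin.succ j') := by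
  rw [← Fin.succ_zero_eq_one, Fin.succ_succAbove_succ, Fin.succAbove_zero]

/-- The affine coordinates of `[t : 1 : 0 : ⋯ : 0]` in the chart `{z₁ ≠ 0}` are `(t, 0, …, 0)`.
[folklore] -/
theorem affineCoordComplex_one_mk_lineVec (t : ℂ) :
    affineCoordComplex 1 (mk (lineVec (n := n) t)) = Fin.cons t 0 := by
  rw [affineCoordComplex_mk]
  funext j
  rw [lineVec_one, div_one]
  refine Fin.cases ?_ (fun j' => ?_) j
  · rw [Fin.cons_zero, show (1 : Fin (n + 2)).succAbove 0 = 0 from rfl, lineVec_zero]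
  · rw [Fin.cons_succ, Pi.zero_apply, one_succAbove_succ, lineVec_succ_succ]

/-- `insertNth 1 1 (t, 0, …, 0) = (t, 1, 0, …, 0)`. [folklore] -/
theorem insertNth_one_cons (t : ℂ) :
    (Fin.insertNth 1 (1 : ℂ) (Fin.cons t 0 : Fin (n + 1) → ℂ) : Fin (n + 2) → ℂ) =
      (lineVec (n := n) t : Fin (n + 2) → ℂ) := by
  funext j
  rcases Fin.eq_self_or_eq_succAbove 1 j with rfl | ⟨j', rfl⟩
  · rw [Fin.insertNth_apply_same, lineVec_one]
  · rw [Fin.insertNth_apply_succAbove]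
    refine Fin.cases ?_ (fun j'' => ?_) j'
    · rw [Fin.cons_zero, show (1 : Fin (n + 2)).succAbove 0 = 0 from rfl, lineVec_zero]
    · rw [Fin.cons_succ, Pi.zero_apply, one_succAbove_succ, lineVec_succ_succ]

/-- `[t : 1 : 0 : ⋯ : 0]` lies on the line. [folklore] -/
theorem mk_lineVec_mem_line (t : ℂ) : mk (lineVec (n := n) t) ∈ (line : Set (ComplexProjectiveSpace (n + 1))) := by
  rw [mk_mem_line_iff]
  intro j hj
  obtain ⟨j', rfl⟩ : ∃ j', j = Fin.succ (Fin.succ j') := by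
    rcases Fin.eq_zero_or_eq_succ j with rfl | ⟨l, rfl⟩
    · simp at hj
    rcases Fin.eq_zero_or_eq_succ l with rfl | ⟨j', rfl⟩
    · simp at hj
    · exact ⟨j', rfl⟩
  exact lineVec_succ_succ t j'

/-- `t ↦ [t : 1 : 0 : ⋯ : 0]` is injective. [folklore] -/
theorem mk_lineVec_injective : Injective fun t : ℂ => mk (lineVec (n := n) t) := by
  intro t t' h
  have := congrArg (affineCoordComplex 1) h
  dsimp only at this
  rw [affineCoordComplex_one_mk_lineVec, affineCoordComplex_one_mk_lineVec] at this
  simpa using congr_fun this 0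

namespace Setup

variable (S : Setup n)

/-- **The derivative of `g` is `∂₀G` along the line**: `g'(t) = (∂₀G)(t, 1, 0, …, 0)`. [folklore] -/
theorem eval_derivative_eq (t : ℂ) :
    (Polynomial.derivative S.g).eval t =
      MvPolynomial.eval (lineVec (n := n) t : Fin (n + 2) → ℂ) (MvPolynomial.pderiv 0 S.G) := by
  -- `γ(s) = (s, 1, 0, …, 0) = s • e₀ + (0, 1, 0, …, 0)` has derivative `e₀`
  have hγeq : (fun s : ℂ => (Fin.cons s (Pi.single 0 1) : Fin (n + 2) → ℂ)) =
      fun s => s • (Pi.single 0 1 : Fin (n + 2) → ℂ) + Fin.cons 0 (Pi.single 0 1) := by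
    funext s; funext j
    refine Fin.cases ?_ (fun j' => ?_) j
    · simp
    · simp [Fin.succ_ne_zero]
  have hγ : HasDerivAt (fun s : ℂ => (Fin.cons s (Pi.single 0 1) : Fin (n + 2) → ℂ))
      (Pi.single 0 1) t := by
    rw [hγeq]
    have h := ((hasDerivAt_id t).smul_const (Pi.single (0 : Fin (n + 2)) (1 : ℂ))).add_const
      (Fin.cons (0 : ℂ) (Pi.single (0 : Fin (n + 1)) (1 : ℂ)) : Fin (n + 2) → ℂ)
    simpa using h
  have hcomp := (hasFDerivAt_mvPolynomial_eval S.G _).comp_hasDerivAt t hγ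
  have hgd : HasDerivAt (fun s => S.g.eval s) ((Polynomial.derivative S.g).eval t) t := S.g.hasDerivAt t
  have heq : (fun s => S.g.eval s) = fun s => MvPolynomial.eval (Fin.cons s (Pi.single 0 1) : Fin (n + 2) → ℂ) S.G :=
    funext S.hg
  rw [heq] at hgd
  rw [hgd.unique hcomp, evalDeriv_apply, Finset.sum_eq_single (0 : Fin (n + 2))
    (fun j _ hj => by rw [Pi.single_eq_of_ne hj, mul_zero]) (fun h => (h (Finset.mem_univ _)).elim)]
  simp [lineVec]

/-- The crossing point `[t : 1 : 0 : ⋯ : 0] ∈ Z_G` at a root `t` of `g`. [folklore] -/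
def crossing {t : ℂ} (ht : S.g.eval t = 0) : S.Z :=
  ⟨ComplexProjectiveSpace.mk (lineVec t), by
    rw [mk_mem_zeroSet_iff]
    change MvPolynomial.eval (Fin.cons t (Pi.single 0 1)) S.G = 0
    rw [← S.hg, ht]⟩

/-- **The graph chart data at a crossing**: chart `{z₁ ≠ 0}`, dependent slot `w₀ = z₀/z₁`, valid
since `∂f/∂w₀ = (∂₀G)(t, 1, 0, …, 0) = g'(t) ≠ 0` at a simple root. [cite: GriffithsHarrisPrinciples1978, Ch. 0 §2] -/
def crossingData {t : ℂ} (ht : S.g.eval t = 0) : ChartData S.G S.hG where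
  p := S.crossing ht
  i := 1
  k := 0
  hi := by change ((lineVec (n := n) t : Fin (n + 2) → ℂ)) 1 ≠ 0; rw [lineVec_one]; exact one_ne_zero
  hk := by
    change fChartDeriv S.G 1 (affineCoordComplex 1 (ComplexProjectiveSpace.mk (lineVec (n := n) t))) (Pi.single 0 1) ≠ 0
    rw [fChartDeriv_single, affineCoordComplex_one_mk_lineVec, insertNth_one_cons,
      show (1 : Fin (n + 2)).succAbove 0 = 0 from rfl, ← S.eval_derivative_eq]
    exact S.hsimple t ht

/-! ### The Euclidean models at the crossings -/

/-- The (finite) type of roots of `g`. [folklore] -/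
abbrev Roots : Type := ↥(S.g.rootSet ℂ)

/-- Roots are roots. [folklore] -/
theorem eval_root (t : S.Roots) : S.g.eval (t : ℂ) = 0 := by
  have h := (Polynomial.mem_rootSet.1 t.2).2
  rwa [Polynomial.coe_aeval_eq_eval] at h

/-- The crossing at a root. [folklore] -/
def yR (t : S.Roots) : S.Z := S.crossing (S.eval_root t)

/-- The graph chart data at a root. [folklore] -/
def DR (t : S.Roots) : ChartData S.G S.hG := S.crossingData (S.eval_root t)

/-- `t ↦ y_t` is injective. [folklore] -/
theorem yR_injective : Injective S.yR := by
  intro a b h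
  have h' : ComplexProjectiveSpace.mk (lineVec (n := n) (a : ℂ)) =
      ComplexProjectiveSpace.mk (lineVec (n := n) (b : ℂ)) := congrArg (fun q : S.Z => q.1) h
  exact Subtype.ext (mk_lineVec_injective h')

/-- The open set of the hypersurface away from the other crossings. [folklore] -/
def W (t : S.Roots) : Set S.Z := {q | ∀ s : S.Roots, s ≠ t → q ≠ S.yR s}

/-- `W_t` is open. [folklore] -/
theorem isOpen_W (t : S.Roots) : IsOpen (S.W t) := by
  classical
  have : S.W t = ⋂ s ∈ (Finset.univ.filter fun s : S.Roots => s ≠ t), {S.yR s}ᶜ := by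
    ext q; simp [W]
  rw [this]
  exact isOpen_biInter_finset fun _ _ => isClosed_singleton.isOpen_compl

/-- `y_t ∈ W_t`. [folklore] -/
theorem yR_mem_W (t : S.Roots) : S.yR t ∈ S.W t :=
  fun _ hs h => hs ((S.yR_injective h).symm)

/-- The restricted graph chart at the crossing `t`. [folklore] -/
def ch (t : S.Roots) : OpenPartialHomeomorph S.Z (EuclideanSpace ℝ (Fin (2 * n))) :=
  (S.DR t).graphChart.restrOpen (S.W t) (S.isOpen_W t)

/-- The restricted graph chart is in the atlas sense a restriction of an atlas chart. [folklore] -/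
theorem graphChart_DR_mem_atlas (t : S.Roots) :
    (S.DR t).graphChart ∈ atlas (EuclideanSpace ℝ (Fin (2 * n))) S.Z :=
  graphChart_mem_atlas S.G S.hG S.hNS (S.DR t)

/-- The crossing lies in the source of its chart. [folklore] -/
theorem yR_mem_source (t : S.Roots) : S.yR t ∈ (S.ch t).source := by
  refine ⟨?_, S.yR_mem_W t⟩
  rw [ChartData.graphChart_source]
  exact (S.DR t).p_mem_source

/-- The chart reads `q ↦ R (tailCoord q)`. [folklore] -/
theorem ch_apply (t : S.Roots) (q : S.Z) : S.ch t q = realCoordinates n (tailCoord q.1) := by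
  change (S.DR t).graphChart q = _
  rw [ChartData.graphChart_apply, ChartData.graphChartC_apply]
  rfl

/-- The chart value of the crossing is `0`. [folklore] -/
theorem ch_yR (t : S.Roots) : S.ch t (S.yR t) = 0 := by
  rw [ch_apply]
  change realCoordinates n (Fin.removeNth 0 (affineCoordComplex 1 (ComplexProjectiveSpace.mk (lineVec (n := n) (t : ℂ))))) = 0
  rw [affineCoordComplex_one_mk_lineVec]
  have : Fin.removeNth 0 (Fin.cons (t : ℂ) (0 : Fin n → ℂ) : Fin (n + 1) → ℂ) = 0 := by
    funext j; simp [Fin.removeNth]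
  rw [this, map_zero]

/-- `0` lies in the target of the chart at the crossing. [folklore] -/
theorem zero_mem_target (t : S.Roots) : (0 : EuclideanSpace ℝ (Fin (2 * n))) ∈ (S.ch t).target := by
  rw [← S.ch_yR t]
  exact (S.ch t).map_source (S.yR_mem_source t)

/-- The Euclidean model at the crossing: the inverse of the restricted chart. [folklore] -/
def eR (t : S.Roots) : ↥(S.ch t).target ≃ₜ ↥(S.ch t).source := (S.ch t).toHomeomorphSourceTarget.symm

/-- The model point `0` goes to the crossing. [folklore] -/
theorem eR_zero (t : S.Roots) :
    ((S.eR t ⟨0, S.zero_mem_target t⟩ : ↥(S.ch t).source) : S.Z) = S.yR t := by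
  change (S.ch t).symm 0 = S.yR t
  rw [← S.ch_yR t]
  exact (S.ch t).left_inv (S.yR_mem_source t)

/-- The normal coordinate read in the model: `f_t(u) = clamp (R (tailCoord (chart⁻¹ u)))`. [folklore] -/
def fR (t : S.Roots) (u : EuclideanSpace ℝ (Fin (2 * n))) : EuclideanSpace ℝ (Fin (2 * n)) :=
  clamp (realCoordinates n (tailCoord (((S.ch t).symm u : S.Z) : ComplexProjectiveSpace (n + 1))))

/-- **`f_t` is the identity near `0`** (the clamp is the identity on the unit ball and the chart
reads the normal coordinates). [folklore] -/
theorem fR_eventuallyEq_id (t : S.Roots) : S.fR t =ᶠ[𝓝 0] id := by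
  have hmem : (S.ch t).target ∩ ball 0 1 ∈ 𝓝 (0 : EuclideanSpace ℝ (Fin (2 * n))) :=
    Filter.inter_mem ((S.ch t).open_target.mem_nhds (S.zero_mem_target t)) (ball_mem_nhds 0 one_pos)
  filter_upwards [hmem] with u hu
  have h1 : realCoordinates n (tailCoord (((S.ch t).symm u : S.Z) : ComplexProjectiveSpace (n + 1))) = u := by
    rw [← S.ch_apply t]
    exact (S.ch t).right_inv hu.1
  rw [fR, h1, id]
  exact clamp_of_norm_le (le_of_lt (mem_ball_zero_iff.1 hu.2))

/-- Hence `f_t` has derivative the identity at `0`. [folklore] -/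
theorem hasFDerivAt_fR (t : S.Roots) : HasFDerivAt (S.fR t) (ContinuousLinearMap.id ℝ _) 0 :=
  (hasFDerivAt_id (0 : EuclideanSpace ℝ (Fin (2 * n)))).congr_of_eventuallyEq (S.fR_eventuallyEq_id t)

/-! ### The crossing set -/

/-- **The hypersurface meets the line exactly at the crossings `y_t`, `g(t) = 0`.** [folklore] -/
theorem setOf_mem_line_eq :
    {q : S.Z | q.1 ∈ (line : Set (ComplexProjectiveSpace (n + 1)))} =
      ⋃ t ∈ (Finset.univ : Finset S.Roots),
        {((S.eR t ⟨0, S.zero_mem_target t⟩ : ↥(S.ch t).source) : S.Z)} := by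
  ext q
  simp only [mem_setOf_eq, Finset.mem_univ, iUnion_true, mem_iUnion, mem_singleton_iff, eR_zero]
  constructor
  · intro hq
    obtain ⟨v, hv⟩ := mk_surjective q.1
    have h1 : CoordNeZero 1 q.1 := S.coordNeZero_one_of_mem_line' q.2 hq
    rw [← hv] at h1 hq
    have hv1 : (v : Fin (n + 2) → ℂ) 1 ≠ 0 := h1
    rw [mk_mem_line_iff] at hq
    set t₀ : ℂ := (v : Fin (n + 2) → ℂ) 0 / (v : Fin (n + 2) → ℂ) 1 with ht₀
    have hvec : (v : Fin (n + 2) → ℂ) = (v : Fin (n + 2) → ℂ) 1 • (lineVec (n := n) t₀ : Fin (n + 2) → ℂ) := by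
      funext j
      rw [Pi.smul_apply, smul_eq_mul]
      rcases Fin.eq_zero_or_eq_succ j with rfl | ⟨j', rfl⟩
      · rw [lineVec_zero, ht₀, mul_div_cancel₀ _ hv1]
      rcases Fin.eq_zero_or_eq_succ j' with rfl | ⟨j'', rfl⟩
      · rw [Fin.succ_zero_eq_one, lineVec_one, mul_one]
      · rw [lineVec_succ_succ, mul_zero, hq _ (by simp)]
    have hmk : ComplexProjectiveSpace.mk v = ComplexProjectiveSpace.mk (lineVec (n := n) t₀) :=
      (mk_eq_mk_iff _ _).2 ⟨Units.mk0 _ hv1, by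
        change (v : Fin (n + 2) → ℂ) 1 • (lineVec (n := n) t₀ : Fin (n + 2) → ℂ) = v
        exact hvec.symm⟩
    have hroot : S.g.eval t₀ = 0 := by
      have hz := q.2
      rw [← hv, hmk, mk_mem_zeroSet_iff] at hz
      rw [S.hg]; exact hz
    have ht₀mem : t₀ ∈ S.g.rootSet ℂ :=
      Polynomial.mem_rootSet.2 ⟨S.hg0, by rwa [Polynomial.coe_aeval_eq_eval]⟩
    refine ⟨⟨t₀, ht₀mem⟩, Subtype.ext ?_⟩
    change q.1 = ComplexProjectiveSpace.mk (lineVec (n := n) t₀)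
    rw [← hv, hmk]
  · rintro ⟨t, rfl⟩
    exact mk_lineVec_mem_line (n := n) (t : ℂ)

/-! ### Milnor's sum over the crossings -/

variable (gE : HomologicalOrientation ℤ (EuclideanSpace ℝ (Fin (2 * n))) (2 * n))

/-- The identity has determinant `1` (bookkeeping). [folklore] -/
theorem det_id_ne_zero :
    LinearMap.det ((ContinuousLinearMap.id ℝ (EuclideanSpace ℝ (Fin (2 * n))) :
      EuclideanSpace ℝ (Fin (2 * n)) →L[ℝ] EuclideanSpace ℝ (Fin (2 * n))) :
      EuclideanSpace ℝ (Fin (2 * n)) →ₗ[ℝ] EuclideanSpace ℝ (Fin (2 * n))) = 1 :=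
  LinearMap.det_id

/-- **The transverse-disc functional on `ι_*[Z_G]` is `(#crossings) · w₀`** (Milnor 1965, Lemma 6.3,
in the tree's form `functional_ofAbsolute_map_eq_sum`: every crossing is transversal with local
degree `+1`, and the local orientation class of the complex orientation is the model class).
[cite: MilnorHCobordism1965, Lemma 6.3] [cite: GriffithsHarrisPrinciples1978, Ch. 0 §4] -/
theorem functional_fundamentalClass_eq :
    (datum n).functional (empty_subset _) (2 * n)
        ((singularHomology.map ℤ ℤ S.inclXp (2 * n) ≫
          relativeSingularHomology.ofAbsolute ℤ ℤ (Xp n) ∅ (2 * n))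
          (orientation S.G S.hG S.hNS gE).fundamentalClass) =
      (Fintype.card S.Roots : ℤ) • (datum n).baseClass gE := by
  classical
  have key := (datum n).functional_ofAbsolute_map_eq_sum gE (empty_subset _) S.inclXp
    (ι := S.Roots) (U := fun t => (S.ch t).source)
    (fun t q hq => by
      have h := hq.1
      rw [ChartData.graphChart_source] at h
      exact h.1)
    (V := fun t => (S.ch t).target) (fun t => (S.ch t).open_target)
    (c := fun _ => 0) (fun t => S.zero_mem_target t) (fun t => S.eR t)
    (fun t l hl => by
      rw [eR_zero]
      intro hmem
      exact hmem.2 l hl rfl)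
    S.setOf_mem_line_eq
    (fun t => S.fR t) (fun t u => rfl)
    (L := fun _ => ContinuousLinearMap.id ℝ _) (fun t => S.hasFDerivAt_fR t)
    (fun t => by rw [det_id_ne_zero]; exact one_ne_zero)
    (orientation S.G S.hG S.hNS gE).fundamentalClass (fun _ => 1)
    (fun t => by
      rw [one_smul]
      refine (orientation_localClass_symm_restrOpen S.G S.hG S.hNS gE (S.graphChart_DR_mem_atlas t)
        (S.isOpen_W t) ⟨0, S.zero_mem_target t⟩).trans ?_
      exact (HomologicalOrientation.isFundamentalClass_fundamentalClass_holds (2 * n)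
        (orientation S.G S.hG S.hNS gE) _).symm)
  rw [key]
  congr 1
  simp

/-! ### Conclusion: a class detecting `ι_*[Z_G]` -/

variable (hroot : ∃ t, S.g.eval t = 0)

include hroot in
/-- There is at least one crossing. [folklore] -/
theorem card_roots_pos : 0 < Fintype.card S.Roots := by
  obtain ⟨t, ht⟩ := hroot
  exact Fintype.card_pos_iff.2 ⟨⟨t, Polynomial.mem_rootSet.2 ⟨S.hg0, by rwa [Polynomial.coe_aeval_eq_eval]⟩⟩⟩

include hroot in
/-- **A `ℤ`-linear functional on `H₂ₙ(ℂℙⁿ⁺¹ ∖ [e₀]; ℤ)` detecting `ι_*[Z_G]`.** [cite: MilnorHCobordism1965, Lemma 6.3] -/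
theorem exists_linearMap_map_inclXp_ne_zero :
    ∃ fZ : singularHomology ℤ ℤ (Xp n) (2 * n) →ₗ[ℤ] ℤ,
      fZ (singularHomology.map ℤ ℤ S.inclXp (2 * n) (orientation S.G S.hG S.hNS gE).fundamentalClass) ≠ 0 := by
  obtain ⟨eZ, heZ⟩ := (datum n).isGenerator_baseClass gE
  refine ⟨eZ.toLinearMap ∘ₗ ((datum n).functional (empty_subset _) (2 * n)).hom ∘ₗ
    (relativeSingularHomology.ofAbsolute ℤ ℤ (Xp n) ∅ (2 * n)).hom, ?_⟩
  have h := S.functional_fundamentalClass_eq gE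
  rw [ModuleCat.comp_apply] at h
  change eZ ((datum n).functional (empty_subset _) (2 * n)
    (relativeSingularHomology.ofAbsolute ℤ ℤ (Xp n) ∅ (2 * n)
      (singularHomology.map ℤ ℤ S.inclXp (2 * n) (orientation S.G S.hG S.hNS gE).fundamentalClass))) ≠ 0
  rw [h, map_zsmul, heZ, smul_eq_mul, mul_one]
  exact_mod_cast (S.card_roots_pos hroot).ne'

/-- **Removing a point does not change `H₂ₙ` of `ℂℙⁿ⁺¹`**: the inclusion `ℂℙⁿ⁺¹ ∖ [e₀] → ℂℙⁿ⁺¹`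
is bijective on `H₂ₙ` (long exact sequence of the pair; the local homology at a point of the
`(2n+2)`-manifold vanishes in degrees `2n`, `2n + 1`, Hatcher §3.3 p. 231). [cite: HatcherAT2002, §3.3 p. 231] -/
theorem bijective_map_subtypeVal_compl_pInf :
    Bijective (singularHomology.map ℤ ℤ
      (⟨Subtype.val, continuous_subtype_val⟩ : C(Xp n, ComplexProjectiveSpace (n + 1))) (2 * n)) := by
  have hz1 : Limits.IsZero (relativeSingularHomology ℤ ℤ (ComplexProjectiveSpace (n + 1))
      ({pInf}ᶜ : Set (ComplexProjectiveSpace (n + 1))) (2 * n + 1)) :=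
    isZero_localHomology_of_ne (n := 2 * (n + 1)) ℤ ℤ (pInf : ComplexProjectiveSpace (n + 1)) (by omega)
  have hz0 : Limits.IsZero (relativeSingularHomology ℤ ℤ (ComplexProjectiveSpace (n + 1))
      ({pInf}ᶜ : Set (ComplexProjectiveSpace (n + 1))) (2 * n)) :=
    isZero_localHomology_of_ne (n := 2 * (n + 1)) ℤ ℤ (pInf : ComplexProjectiveSpace (n + 1)) (by omega)
  constructor
  · have hmono := (relativeSingularHomology.exact_δ_map (R := ℤ) (M := ℤ)
      ({pInf}ᶜ : Set (ComplexProjectiveSpace (n + 1))) (2 * n)).mono_g (hz1.eq_of_src _ _)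
    exact (ModuleCat.mono_iff_injective _).1 hmono
  · have hepi := (relativeSingularHomology.exact_map_ofAbsolute (R := ℤ) (M := ℤ)
      ({pInf}ᶜ : Set (ComplexProjectiveSpace (n + 1))) (2 * n)).epi_f (hz0.eq_of_tgt _ _)
    exact (ModuleCat.epi_iff_surjective _).1 hepi

include hroot in
/-- **The degree of the smooth hypersurface is non-zero, integrally**: there is a class
`α ∈ H²ⁿ(ℂℙⁿ⁺¹; ℤ)` with `⟨ι^* α, [Z_G]⟩ ≠ 0` (Voisin II §1.2.3: `⟨hⁿ, [Y]⟩ = deg Y = d`;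
Griffiths–Harris Ch. 1 §3: the degree is the number of intersection points with a transversal line,
each counted `+1`). [cite: VoisinHodgeII2003, §1.2.3 Rem. 1.26] [cite: GriffithsHarrisPrinciples1978, Ch. 1 §3] -/
theorem exists_kroneckerPairing_map_fundamentalClass_ne_zero :
    ∃ α : singularCohomology ℤ ℤ (ComplexProjectiveSpace (n + 1)) (2 * n),
      kroneckerPairing ℤ ℤ S.Z (2 * n) (singularCohomology.map ℤ ℤ S.inclC (2 * n) α)
          (orientation S.G S.hG S.hNS gE).fundamentalClass ≠ 0 := by
  obtain ⟨fZ, hfZ⟩ := S.exists_linearMap_map_inclXp_ne_zero gE hroot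
  set j : C(Xp n, ComplexProjectiveSpace (n + 1)) := ⟨Subtype.val, continuous_subtype_val⟩ with hj
  set ej := LinearEquiv.ofBijective (singularHomology.map ℤ ℤ j (2 * n)).hom
    (bijective_map_subtypeVal_compl_pInf (n := n)) with hej
  set fZ' : singularHomology ℤ ℤ (ComplexProjectiveSpace (n + 1)) (2 * n) →ₗ[ℤ] ℤ := fZ ∘ₗ ej.symm.toLinearMap
  obtain ⟨α, hα⟩ := kroneckerPairing_surjective ℤ (ComplexProjectiveSpace (n + 1)) (2 * n) fZ'
  refine ⟨α, ?_⟩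
  rw [kroneckerPairing_map, hα]
  have hfac : S.inclC = j.comp S.inclXp := rfl
  rw [hfac, singularHomology.map_comp, ModuleCat.comp_apply]
  change fZ (ej.symm (ej (singularHomology.map ℤ ℤ S.inclXp (2 * n)
    (orientation S.G S.hG S.hNS gE).fundamentalClass))) ≠ 0
  rw [LinearEquiv.symm_apply_apply]
  exact hfZ

end Setup

end HypersurfaceDegree

end Literature.AlgebraicGeometry.HodgeTheory

end


/-! ## Part II — Lefschetz in the upper range `n < 2p < 2n` and the discharge of
`Voisin2003_smoothHypersurface_algebraicClasses_eq_top` (see the file header) -/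

noncomputable section

open CategoryTheory AlgebraicGeometry Set Function Topology Filter
open scoped ContDiff

namespace Literature.AlgebraicGeometry.HodgeTheory

open Literature.Topology.FourManifolds Literature.Topology.FourManifolds.ComplexProjectiveSpace
  Literature.AlgebraicTopology.SingularHomology Literature.AlgebraicGeometry.Motives

universe u

variable {n : ℕ}

/-! ### Non-singularity is invariant under invertible linear substitutions -/

/-- The derivative of `z ↦ G(z) = F(A z)` is `F'(A z) ∘ A`. [folklore] -/
theorem evalDeriv_linSubst (A : (Fin (n + 2) → ℂ) ≃ₗ[ℂ] (Fin (n + 2) → ℂ)) (F : MvPolynomial (Fin (n + 2)) ℂ)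
    (z : Fin (n + 2) → ℂ) :
    evalDeriv (TransversalLine.linSubst (A : (Fin (n + 2) → ℂ) →ₗ[ℂ] (Fin (n + 2) → ℂ)) F) z =
      (evalDeriv F (A z)).comp (A.toContinuousLinearEquiv : (Fin (n + 2) → ℂ) →L[ℂ] (Fin (n + 2) → ℂ)) := by
  have h1 := hasFDerivAt_mvPolynomial_eval
    (TransversalLine.linSubst (A : (Fin (n + 2) → ℂ) →ₗ[ℂ] (Fin (n + 2) → ℂ)) F) z
  have hfun : (fun w => MvPolynomial.eval w
      (TransversalLine.linSubst (A : (Fin (n + 2) → ℂ) →ₗ[ℂ] (Fin (n + 2) → ℂ)) F)) =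
      fun w => MvPolynomial.eval (A.toContinuousLinearEquiv w) F := by
    funext w; rw [TransversalLine.eval_linSubst]; rfl
  rw [hfun] at h1
  have h2 : HasFDerivAt (fun w => MvPolynomial.eval (A.toContinuousLinearEquiv w) F)
      ((evalDeriv F (A z)).comp (A.toContinuousLinearEquiv : (Fin (n + 2) → ℂ) →L[ℂ] (Fin (n + 2) → ℂ))) z :=
    (hasFDerivAt_mvPolynomial_eval F _).comp z A.toContinuousLinearEquiv.hasFDerivAt
  exact h1.unique h2

/-- All partial derivatives vanish iff the derivative vanishes. [folklore] -/
theorem evalDeriv_eq_zero_iff {m : ℕ} (F : MvPolynomial (Fin m) ℂ) (z : Fin m → ℂ) :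
    evalDeriv F z = 0 ↔ ∀ j, MvPolynomial.eval z (MvPolynomial.pderiv j F) = 0 := by
  constructor
  · intro h j
    have := congrArg (fun L : (Fin m → ℂ) →L[ℂ] ℂ => L (Pi.single j 1)) h
    simp only [evalDeriv_apply] at this
    rw [show (0 : (Fin m → ℂ) →L[ℂ] ℂ) (Pi.single j 1) = 0 from rfl] at this
    rw [Finset.sum_eq_single j (fun i _ hij => by rw [Pi.single_eq_of_ne hij, mul_zero])
      (fun h => (h (Finset.mem_univ j)).elim)] at this
    simpa using this
  · intro h
    ext v
    simp [evalDeriv_apply, h]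

/-- **Non-singularity is invariant under invertible linear substitutions.** [folklore] -/
theorem isNonsingular_linSubst (A : (Fin (n + 2) → ℂ) ≃ₗ[ℂ] (Fin (n + 2) → ℂ)) {F : MvPolynomial (Fin (n + 2)) ℂ}
    (hF : IsNonsingular F) :
    IsNonsingular (TransversalLine.linSubst (A : (Fin (n + 2) → ℂ) →ₗ[ℂ] (Fin (n + 2) → ℂ)) F) := by
  intro z hz hGz
  by_contra hcon
  push Not at hcon
  have hD : evalDeriv (TransversalLine.linSubst (A : (Fin (n + 2) → ℂ) →ₗ[ℂ] (Fin (n + 2) → ℂ)) F) z = 0 :=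
    (evalDeriv_eq_zero_iff _ z).2 hcon
  rw [evalDeriv_linSubst] at hD
  have hDF : evalDeriv F (A z) = 0 := by
    ext w
    have := congrArg (fun L : (Fin (n + 2) → ℂ) →L[ℂ] ℂ => L (A.symm w)) hD
    simpa using this
  have hAz : A z ≠ 0 := fun h => hz (by simpa using congrArg A.symm h)
  have hFz : MvPolynomial.eval (A z) F = 0 := by rwa [TransversalLine.eval_linSubst] at hGz
  obtain ⟨j, hj⟩ := hF (A z) hAz hFz
  exact hj ((evalDeriv_eq_zero_iff F (A z)).1 hDF j)

/-! ### The restriction to the line has a root -/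

/-- **The restriction `g(t) = G(t, 1, 0, …, 0)` of a form of degree `d ≥ 1` with `G(e₀) ≠ 0` to the
coordinate line has a root** (a line meets a hypersurface of positive degree): otherwise `g` is a
non-zero constant `c`, and `G(e₀ + s e₁) = sᵈ g(1/s) = c sᵈ → 0` as `s → 0`, against
`G(e₀) ≠ 0`. [cite: GriffithsHarrisPrinciples1978, Ch. 1 §3] -/
theorem exists_eval_eq_zero_of_normalForm {G : MvPolynomial (Fin (n + 2)) ℂ} {d : ℕ}
    (hG : G.IsHomogeneous d) (hd : 0 < d) (hG₀ : MvPolynomial.eval (Pi.single 0 1) G ≠ 0)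
    {g : Polynomial ℂ} (hg : ∀ t : ℂ, g.eval t = MvPolynomial.eval (Fin.cons t (Pi.single 0 1)) G) :
    ∃ t, g.eval t = 0 := by
  by_contra hno
  push Not at hno
  -- `g` is a non-zero constant `c`
  have hdeg : g.degree ≤ 0 := by
    by_contra hpos
    push Not at hpos
    obtain ⟨t, ht⟩ := Complex.exists_root hpos
    exact hno t ht
  obtain ⟨c, hc⟩ : ∃ c, g = Polynomial.C c := ⟨_, Polynomial.eq_C_of_degree_le_zero hdeg⟩
  have hc0 : c ≠ 0 := fun h => hno 0 (by rw [hc, h, map_zero, Polynomial.eval_zero])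
  -- `ψ(s) = G(e₀ + s e₁)` is continuous, `ψ(0) = G(e₀)`, and `ψ(s) = c sᵈ` for `s ≠ 0`
  set ψ : ℂ → ℂ := fun s => MvPolynomial.eval
    ((Pi.single 0 1 : Fin (n + 2) → ℂ) + s • Fin.cons 0 (Pi.single 0 1)) G with hψ
  have hψc : Continuous ψ :=
    (MvPolynomial.continuous_eval G).comp (continuous_const.add (continuous_id.smul continuous_const))
  have hψ0 : ψ 0 = MvPolynomial.eval (Pi.single 0 1) G := by simp [hψ]
  have hψs : ∀ s : ℂ, s ≠ 0 → ψ s = c * s ^ d := by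
    intro s hs
    have hvec : ((Pi.single 0 1 : Fin (n + 2) → ℂ) + s • Fin.cons 0 (Pi.single 0 1)) =
        s • (Fin.cons s⁻¹ (Pi.single 0 1) : Fin (n + 2) → ℂ) := by
      funext j
      refine Fin.cases ?_ (fun j' => ?_) j
      · simp [hs]
      · simp [Fin.succ_ne_zero]
    rw [hψ]
    dsimp only
    rw [hvec, hG.eval_smul_eq, ← hg, hc, Polynomial.eval_C, mul_comm]
  -- the two limits at `0` disagree
  have hlim1 : Tendsto ψ (𝓝[≠] 0) (𝓝 (ψ 0)) := hψc.continuousAt.tendsto.mono_left nhdsWithin_le_nhds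
  have hlim2 : Tendsto ψ (𝓝[≠] 0) (𝓝 0) := by
    have h : Tendsto (fun s : ℂ => c * s ^ d) (𝓝[≠] 0) (𝓝 0) := by
      have : Tendsto (fun s : ℂ => c * s ^ d) (𝓝 0) (𝓝 (c * 0 ^ d)) :=
        (continuous_const.mul (continuous_pow d)).continuousAt.tendsto
      rw [zero_pow hd.ne', mul_zero] at this
      exact this.mono_left nhdsWithin_le_nhds
    refine h.congr' ?_
    filter_upwards [self_mem_nhdsWithin] with s hs
    exact (hψs s hs).symm
  have := tendsto_nhds_unique hlim1 hlim2
  rw [hψ0] at this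
  exact hG₀ this

/-! ### Linear changes of coordinates of `ℂℙᴺ` -/

section LinHomeo

variable {N : ℕ}

/-- The projective transformation `[v] ↦ [B v]` of an invertible linear map. [folklore] -/
def linMap (B : (Fin (N + 1) → ℂ) ≃ₗ[ℂ] (Fin (N + 1) → ℂ)) : ComplexProjectiveSpace N → ComplexProjectiveSpace N :=
  Projectivization.lift (fun v => ComplexProjectiveSpace.mk ⟨B v, fun h => v.2 (by simpa using congrArg B.symm h)⟩) (by
    rintro a b t h
    refine (mk_eq_mk_iff _ _).2 ⟨t, ?_⟩
    change t • B (b : Fin (N + 1) → ℂ) = B (a : Fin (N + 1) → ℂ)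
    rw [h, map_smul])

/-- `linMap B [v] = [B v]`. [folklore] -/
@[simp] theorem linMap_mk (B : (Fin (N + 1) → ℂ) ≃ₗ[ℂ] (Fin (N + 1) → ℂ)) (v : {v : Fin (N + 1) → ℂ // v ≠ 0}) :
    linMap B (ComplexProjectiveSpace.mk v) =
      ComplexProjectiveSpace.mk ⟨B v, fun h => v.2 (by simpa using congrArg B.symm h)⟩ := rfl

/-- Projective transformations are continuous. [folklore] -/
theorem continuous_linMap (B : (Fin (N + 1) → ℂ) ≃ₗ[ℂ] (Fin (N + 1) → ℂ)) : Continuous (linMap B) := by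
  rw [isQuotientMap_mk.continuous_iff]
  exact continuous_mk.comp (Continuous.subtype_mk
    ((B.toContinuousLinearEquiv.continuous).comp continuous_subtype_val) _)

/-- **The homeomorphism of `ℂℙᴺ` induced by an invertible linear map.** [folklore] -/
def linHomeo (B : (Fin (N + 1) → ℂ) ≃ₗ[ℂ] (Fin (N + 1) → ℂ)) : ComplexProjectiveSpace N ≃ₜ ComplexProjectiveSpace N where
  toFun := linMap B
  invFun := linMap B.symm
  left_inv x := by
    induction x using ind with
    | h v => rw [linMap_mk, linMap_mk]; congr 1; exact Subtype.ext (by simp)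
  right_inv x := by
    induction x using ind with
    | h v => rw [linMap_mk, linMap_mk]; congr 1; exact Subtype.ext (by simp)
  continuous_toFun := continuous_linMap B
  continuous_invFun := continuous_linMap B.symm

/-- `linHomeo B [v] = [B v]`. [folklore] -/
@[simp] theorem linHomeo_mk (B : (Fin (N + 1) → ℂ) ≃ₗ[ℂ] (Fin (N + 1) → ℂ)) (v : {v : Fin (N + 1) → ℂ // v ≠ 0}) :
    linHomeo B (ComplexProjectiveSpace.mk v) =
      ComplexProjectiveSpace.mk ⟨B v, fun h => v.2 (by simpa using congrArg B.symm h)⟩ := rfl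

end LinHomeo

/-! ### The cohomology of `ℙᴺ(ℂ)` (complex points) from that of the manifold `ℂℙᴺ` -/

section ProjectiveSpaceBetti

variable (N : ℕ)

/-- **`dim_ℂ H²ᵏ(ℙᴺ(ℂ); ℂ) = 1` for `k ≤ N`** (transport of `finrank_singularCohomology_two_mul_eq_one`
along `ℙᴺ_ℂ(ℂ) ≃ₜ ℂℙᴺ`). Same statement as `finrank_complexBetti_projectiveSpace_two_mul_eq_one`
(`HolomorphicBundleChernCharacterProjectiveSpace`), re-derived here in three lines from
`ComplexProjectiveSpaceCohomology` so as not to import the Kähler / Chern-character closure of that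
file into the Lefschetz chain. [cite: HatcherAT2002, Thm. 3.19] -/
theorem finrank_complexBetti_projectiveSpace_two_mul {k : ℕ} (hk : k ≤ N) :
    Module.finrank ℂ (complexBetti (projectiveSpace N ℂ) (2 * k)) = 1 := by
  rw [← finrank_singularCohomology_two_mul_eq_one ℂ N k hk]
  exact ((forget (ModuleCat ℂ)).mapIso
    (singularCohomology.mapIso ℂ ℂ (complexPointsProjectiveSpaceHomeomorph N) (2 * k))).toEquiv.bijective
    |> fun h => (LinearEquiv.ofBijective
      (singularCohomology.map ℂ ℂ (complexPointsProjectiveSpaceHomeomorph N :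
        C(ComplexPoints (projectiveSpace N ℂ), ComplexProjectiveSpace N)) (2 * k)).hom h).finrank_eq.symm

/-- **Cup products of non-zero classes of `H*(ℙᴺ(ℂ); ℂ)` in degrees `2p, 2q`, `p + q ≤ N`, are
non-zero** (transport of `cupProduct_ne_zero_of_add_le`). [cite: HatcherAT2002, Thm. 3.19] -/
theorem cupProduct_ne_zero_complexBetti_projectiveSpace {p q m : ℕ} (hm : 2 * p + 2 * q = m)
    (hpq : p + q ≤ N) {α : complexBetti (projectiveSpace N ℂ) (2 * p)}
    {β : complexBetti (projectiveSpace N ℂ) (2 * q)} (hα : α ≠ 0) (hβ : β ≠ 0) :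
    cupProduct hm α β ≠ 0 := by
  set e : C(ComplexPoints (projectiveSpace N ℂ), ComplexProjectiveSpace N) :=
    (complexPointsProjectiveSpaceHomeomorph N : C(ComplexPoints (projectiveSpace N ℂ), ComplexProjectiveSpace N))
  have hbij : ∀ k, Bijective (singularCohomology.map ℂ ℂ e k) := fun k =>
    ((forget (ModuleCat ℂ)).mapIso
      (singularCohomology.mapIso ℂ ℂ (complexPointsProjectiveSpaceHomeomorph N) k)).toEquiv.bijective
  obtain ⟨α', rfl⟩ := (hbij (2 * p)).2 α
  obtain ⟨β', rfl⟩ := (hbij (2 * q)).2 β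
  have hα' : α' ≠ 0 := fun h => hα (by rw [h, map_zero])
  have hβ' : β' ≠ 0 := fun h => hβ (by rw [h, map_zero])
  rw [← cupProduct_map]
  intro h0
  exact cupProduct_ne_zero_of_add_le ℂ N hm hpq hα' hβ' ((hbij m).1 (by rw [h0, map_zero]))

end ProjectiveSpaceBetti

/-! ### The upper range: `ι^*` is onto for `n < 2p < 2n` -/

section Upper

variable {d : ℕ} {Y : Motives.SchemeOver ℂ}

-- the grading of `ℂ[x₀, …, x_{n+1}]` by degree
attribute [local instance] MvPolynomial.gradedAlgebra

/-- **`ι^* : H²ⁿ(ℙ^{n+1}(ℂ); ℂ) → H²ⁿ(Y(ℂ); ℂ)` is non-zero for a smooth hypersurface `Y` of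
dimension `n`** — the degree of `Y` is non-zero: `⟨hⁿ, [Y]⟩ = d` (Voisin II §1.2.3; here: the
integral Milnor computation of `SmoothHypersurfaceDegree` in transversal normal form, transported
along `Y(ℂ) ≅ Z_G`, and `ℤ → ℂ`). [cite: VoisinHodgeII2003, §1.2.3 Cor. 1.25 and Rem. 1.26] -/
theorem map_two_mul_ne_zero_of_top (hY : IsSmoothProjective n Y) {F : MvPolynomial (Fin (n + 2)) ℂ}
    (hFhom : F.IsHomogeneous d) (hFirr : Irreducible F) (hred : IsReduced Y.left)
    (ι : Y ⟶ projectiveSpace (n + 1) ℂ) [hι : IsClosedImmersion ι.left]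
    (hrange : Set.range ι.left.base =
      ProjectiveSpectrum.zeroLocus (MvPolynomial.homogeneousSubmodule (Fin (n + 2)) ℂ) {F}) :
    ∃ γ : complexBetti (projectiveSpace (n + 1) ℂ) (2 * n), complexBetti.map ι (2 * n) γ ≠ 0 := by
  have hd : 0 < d := pos_of_irreducible_isHomogeneous hFhom hFirr
  -- Jacobian criterion and transversal normal form
  have hNSF : IsNonsingular F :=
    Hartshorne1977_smoothHypersurface_jacobian_holds n d Y F hY hFhom hFirr ⟨hred, ι, hι, hrange⟩
  obtain ⟨A, g, hG₀, hg0, hg, hsimple⟩ := TransversalLine.exists_linSubst_transversal_line hFhom hFirr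
  set G := TransversalLine.linSubst (A : (Fin (n + 2) → ℂ) →ₗ[ℂ] (Fin (n + 2) → ℂ)) F with hGdef
  have hGhom : G.IsHomogeneous d := TransversalLine.isHomogeneous_linSubst _ hFhom
  have hNSG : IsNonsingular G := isNonsingular_linSubst A hNSF
  let S : HypersurfaceDegree.Setup n :=
    { G := G, d := d, hG := hGhom, hNS := hNSG, hG₀ := hG₀, g := g, hg0 := hg0, hg := hg, hsimple := hsimple }
  have hroot : ∃ t, S.g.eval t = 0 := exists_eval_eq_zero_of_normalForm hGhom hd hG₀ hg
  -- the homeomorphism `ℙ^{n+1}(ℂ) ≃ₜ ℂℙⁿ⁺¹` carrying `ι(Y(ℂ))` onto `Z_G`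
  set Θ : ComplexPoints (projectiveSpace (n + 1) ℂ) ≃ₜ ComplexProjectiveSpace (n + 1) :=
    (complexPointsProjectiveSpaceHomeomorph (n + 1)).trans (linHomeo A.symm) with hΘ
  have hmem : ∀ P : ComplexPoints (projectiveSpace (n + 1) ℂ),
      P ∈ Set.range (AlgPoints.map (L := ℂ) ι) ↔ Θ P ∈ zeroSet G hGhom := by
    intro P
    have h1 := notMem_range_map_iff ι hFhom hd hrange P
    rw [← not_iff_not, h1, hΘ, Homeomorph.trans_apply]
    generalize complexPointsProjectiveSpaceHomeomorph (n + 1) P = x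
    induction x using ind with
    | h v =>
      rw [ComplexProjectiveSpace.mk_mem_hypersurfaceComplement_iff, linHomeo_mk, zeroSet]
      simp only [mem_setOf_eq, not_not, ComplexProjectiveSpace.formNeZero_mk, ne_eq]
      rw [hGdef, TransversalLine.eval_linSubst]
      simp
  have hemb : IsEmbedding (AlgPoints.map (L := ℂ) ι) := AlgPoints.isEmbedding_map_of_isClosedImmersion ι
  let Ψ : ComplexPoints Y ≃ₜ S.Z :=
    hemb.toHomeomorph.trans (Θ.subtype (p := fun P => P ∈ Set.range (AlgPoints.map (L := ℂ) ι))
      (q := fun x => x ∈ zeroSet G hGhom) hmem)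
  have hfac : (S.inclC).comp (Ψ : C(ComplexPoints Y, S.Z)) =
      (Θ : C(ComplexPoints (projectiveSpace (n + 1) ℂ), ComplexProjectiveSpace (n + 1))).comp
        (AlgPoints.mapContinuous (L := ℂ) ι) := rfl
  -- the integral class and the change of coefficients
  obtain ⟨gE⟩ := isOrientableOver_of_simplyConnectedSpace ℤ (EuclideanSpace ℝ (Fin (2 * n))) (n := 2 * n)
  obtain ⟨αZ, hαZ⟩ := S.exists_kroneckerPairing_map_fundamentalClass_ne_zero gE hroot
  have hC : singularCohomology.map ℂ ℂ S.inclC (2 * n)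
      (singularCohomology.ringChange (algebraMap ℤ ℂ) (ComplexProjectiveSpace (n + 1)) (2 * n) αZ) ≠ 0 := by
    rw [← singularCohomology.ringChange_map]
    exact ringChange_ne_zero_of_kroneckerPairing_ne_zero ℂ _ _ hαZ
  -- transport to `Y(ℂ)`
  refine ⟨singularCohomology.map ℂ ℂ
    (Θ : C(ComplexPoints (projectiveSpace (n + 1) ℂ), ComplexProjectiveSpace (n + 1))) (2 * n)
    (singularCohomology.ringChange (algebraMap ℤ ℂ) (ComplexProjectiveSpace (n + 1)) (2 * n) αZ), ?_⟩
  intro h0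
  apply hC
  have hΨinj : Injective (singularCohomology.map ℂ ℂ (Ψ : C(ComplexPoints Y, S.Z)) (2 * n)) :=
    ((forget (ModuleCat ℂ)).mapIso (singularCohomology.mapIso ℂ ℂ Ψ (2 * n))).toEquiv.bijective.1
  apply hΨinj
  rw [map_zero, ← ModuleCat.comp_apply, ← singularCohomology.map_comp, hfac, singularCohomology.map_comp,
    ModuleCat.comp_apply]
  exact h0

/-- **`ι^*` is injective on `H²ᵖ(ℙ^{n+1}(ℂ); ℂ)` for every `p ≤ n`** (from the top degree by the cup
product structure: `α ⌣ β = hⁿ`-line for `α ≠ 0` of degree `2p` and some `β` of degree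
`2(n−p)`, and `ι^*` is multiplicative). [cite: VoisinHodgeII2003, §1.2.3 Cor. 1.25] -/
theorem map_ne_zero_of_le (hY : IsSmoothProjective n Y) {F : MvPolynomial (Fin (n + 2)) ℂ}
    (hFhom : F.IsHomogeneous d) (hFirr : Irreducible F) (hred : IsReduced Y.left)
    (ι : Y ⟶ projectiveSpace (n + 1) ℂ) [IsClosedImmersion ι.left]
    (hrange : Set.range ι.left.base =
      ProjectiveSpectrum.zeroLocus (MvPolynomial.homogeneousSubmodule (Fin (n + 2)) ℂ) {F})
    {p : ℕ} (hp : p ≤ n) {α : complexBetti (projectiveSpace (n + 1) ℂ) (2 * p)} (hα : α ≠ 0) :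
    complexBetti.map ι (2 * p) α ≠ 0 := by
  obtain ⟨γ, hγ⟩ := map_two_mul_ne_zero_of_top hY hFhom hFirr hred ι hrange
  have hγ0 : γ ≠ 0 := fun h => hγ (by rw [h, map_zero])
  -- a non-zero class `β` of degree `2(n - p)`
  obtain ⟨β, hβ⟩ : ∃ β : complexBetti (projectiveSpace (n + 1) ℂ) (2 * (n - p)), β ≠ 0 := by
    have h1 := finrank_complexBetti_projectiveSpace_two_mul (n + 1) (k := n - p) (by omega)
    by_contra hcon
    push Not at hcon
    haveI : Subsingleton (complexBetti (projectiveSpace (n + 1) ℂ) (2 * (n - p))) :=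
      ⟨fun a b => by rw [hcon a, hcon b]⟩
    have : Module.finrank ℂ (complexBetti (projectiveSpace (n + 1) ℂ) (2 * (n - p))) = 0 :=
      Module.finrank_zero_of_subsingleton
    omega
  -- `α ⌣ β ≠ 0` spans the line `H²ⁿ`, so `γ = c • (α ⌣ β)`
  have hm : 2 * p + 2 * (n - p) = 2 * n := by omega
  have hcup : cupProduct hm α β ≠ 0 :=
    cupProduct_ne_zero_complexBetti_projectiveSpace (n + 1) hm (by omega) hα hβ
  obtain ⟨c, hc⟩ := (finrank_eq_one_iff_of_nonzero' _ hcup).1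
    (finrank_complexBetti_projectiveSpace_two_mul (n + 1) (k := n) (by omega)) γ
  intro h0
  apply hγ
  rw [← hc, map_smul]
  change c • singularCohomology.map ℂ ℂ (AlgPoints.mapContinuous (L := ℂ) ι) (2 * n) (cupProduct hm α β) = 0
  rw [cupProduct_map]
  change c • cupProduct hm (complexBetti.map ι (2 * p) α) (complexBetti.map ι (2 * (n - p)) β) = 0
  rw [h0, LinearMap.map_zero₂, smul_zero]

/-- **Lefschetz surjectivity in the lower range, for the defining embedding** (Voisin II Thm. 1.23 /
Cor. 1.24 through duality and Andreotti–Frankel, PROVED in the tree): for `k < n`,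
`ι^* : Hᵏ(ℙ^{n+1}(ℂ); ℂ) → Hᵏ(Y(ℂ); ℂ)` is onto. [cite: VoisinHodgeII2003, §1.2.2 Thm. 1.23] -/
theorem surjective_map_of_lt {m d : ℕ} {Y : Motives.SchemeOver ℂ} (hY : IsSmoothHypersurface m d Y)
    {F : MvPolynomial (Fin (m + 2)) ℂ} (hFhom : F.IsHomogeneous d) (hFirr : Irreducible F)
    (ι : Y ⟶ projectiveSpace (m + 1) ℂ) [IsClosedImmersion ι.left]
    (hrange : Set.range ι.left.base =
      ProjectiveSpectrum.zeroLocus (MvPolynomial.homogeneousSubmodule (Fin (m + 2)) ℂ) {F})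
    {k : ℕ} (hk : k < m) : Surjective (complexBetti.map ι k) :=
  surjective_map_of_isZero_singularHomology_compl_range hY.1 ι (j := 2 * m + 1 - k) (by omega)
    (isZero_singularHomology_compl_range_smoothHypersurface hFhom hFirr ι hrange (by omega))

/-- **Lefschetz surjectivity in the upper range** (Voisin II Cor. 1.25, Poincaré duality on `Y`,
here HL-free): for a smooth hypersurface `Y ⊂ ℙ^{n+1}_ℂ` of dimension `n` and `n < 2p < 2n`,
`ι^* : H²ᵖ(ℙ^{n+1}(ℂ); ℂ) → H²ᵖ(Y(ℂ); ℂ)` is onto: `dim H²ᵖ(Y(ℂ)) = dim H^{2n−2p}(Y(ℂ)) ≤ 1`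
(Poincaré duality on the complex manifold `Y(ℂ)` and the lower range) and `ι^*` is injective on the
line `H²ᵖ(ℙ^{n+1}(ℂ))`. [cite: VoisinHodgeII2003, §1.2.3 Cor. 1.25 (PDF p. 62)] -/
theorem surjective_map_of_upper (hY : IsSmoothHypersurface n d Y) {F : MvPolynomial (Fin (n + 2)) ℂ}
    (hFhom : F.IsHomogeneous d) (hFirr : Irreducible F) (hred : IsReduced Y.left)
    (ι : Y ⟶ projectiveSpace (n + 1) ℂ) [IsClosedImmersion ι.left]
    (hrange : Set.range ι.left.base =
      ProjectiveSpectrum.zeroLocus (MvPolynomial.homogeneousSubmodule (Fin (n + 2)) ℂ) {F})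
    {p : ℕ} (hnp : n < 2 * p) (hpn : p < n) : Surjective (complexBetti.map ι (2 * p)) := by
  have hP : IsSmoothProjective (n + 1) (projectiveSpace (n + 1) ℂ) :=
    isSmoothProjective_projectiveSpace_holds ℂ (n + 1)
  haveI := finite_complexBetti hY.1 (2 * p)
  haveI := finite_complexBetti hP (2 * p)
  -- dimension count
  have hdimY : Module.finrank ℂ (complexBetti Y (2 * p)) ≤ 1 := by
    rw [ComplexPoints.finrank_singularCohomology_eq_of_add_eq ℂ hY.1 (p := 2 * p) (q := 2 * (n - p)) (by omega)]
    calc Module.finrank ℂ (complexBetti Y (2 * (n - p)))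
        ≤ Module.finrank ℂ (complexBetti (projectiveSpace (n + 1) ℂ) (2 * (n - p))) :=
          finrank_complexBetti_le_of_surjective hP ι _ (surjective_map_of_lt hY hFhom hFirr ι hrange (by omega))
      _ = 1 := finrank_complexBetti_projectiveSpace_two_mul (n + 1) (by omega)
  have hdimP : Module.finrank ℂ (complexBetti (projectiveSpace (n + 1) ℂ) (2 * p)) = 1 :=
    finrank_complexBetti_projectiveSpace_two_mul (n + 1) (by omega)
  -- `ι^*` is injective on the line `H²ᵖ(ℙ^{n+1}(ℂ))`, hence onto the (at most) line `H²ᵖ(Y(ℂ))`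
  have hinj : Injective (complexBetti.map ι (2 * p)).hom := by
    intro a b hab
    by_contra hne
    have h := map_ne_zero_of_le hY.1 hFhom hFirr hred ι hrange hpn.le (α := a - b) (sub_ne_zero.2 hne)
    exact h (by rw [map_sub]; exact sub_eq_zero.2 hab)
  have hle : Module.finrank ℂ (complexBetti (projectiveSpace (n + 1) ℂ) (2 * p)) ≤
      Module.finrank ℂ (complexBetti Y (2 * p)) := LinearMap.finrank_le_finrank_of_injective hinj
  have heq : Module.finrank ℂ (complexBetti (projectiveSpace (n + 1) ℂ) (2 * p)) =
      Module.finrank ℂ (complexBetti Y (2 * p)) := by omega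
  exact ((LinearMap.injective_iff_surjective_of_finrank_eq_finrank heq).1 hinj)

end Upper

/-! ### The discharge -/

/-- **Lefschetz's theorem on hyperplane sections for smooth hypersurfaces, off the middle degree —
discharge of the named fact `Voisin2003_smoothHypersurface_algebraicClasses_eq_top`** (Voisin,
*Hodge Theory and Complex Algebraic Geometry II*, §1.2.2 Thm. 1.23, §1.2.3 Cor. 1.24–1.25). For a
smooth hypersurface `Y ⊂ ℙ^{n+1}_ℂ` of dimension `n` and `0 < p < n`, `2p ≠ n`, the pull-back
`ι^* : H²ᵖ(ℙ^{n+1}(ℂ); ℂ) → H²ᵖ(Y(ℂ); ℂ)` is onto — by the Lefschetz theorem (duality and the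
Andreotti–Frankel vanishing) for `2p < n` and by Poincaré duality on `Y(ℂ)` with the non-vanishing
of the degree `⟨hⁿ, [Y]⟩ = d` for `n < 2p < 2n` — and restricted ambient classes are algebraic
(`algebraicClasses_eq_top_of_surjective_map`).
[cite: VoisinHodgeII2003, §1.2.2 Thm. 1.23 and §1.2.3 Cor. 1.24–1.25 (PDF pp. 60–62)] -/
theorem Voisin2003_smoothHypersurface_algebraicClasses_eq_top_holds :
    Voisin2003_smoothHypersurface_algebraicClasses_eq_top := by
  intro n d Y hY p hp0 hpn h2p
  obtain ⟨F, hFhom, hFirr, hred, ι, hι, hrange⟩ := hY.2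
  haveI := hι
  refine algebraicClasses_eq_top_of_surjective_map hY.1 ι ?_
  rcases Nat.lt_or_ge (2 * p) n with hlt | hge
  · exact surjective_map_of_lt hY hFhom hFirr ι hrange hlt
  · exact surjective_map_of_upper hY hFhom hFirr hred ι hrange (by omega) hpn

end Literature.AlgebraicGeometry.HodgeTheory

end
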